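import Summits.Ventures.Crystal3D.Theorems.StickyWulffConstantTextureLiminfTexShadowLevelReachBornBarlow
import HarnessLib

/-!
# Born launches are CHAIN BOTTOMS: the trackable balls of a lamella are at most `K` per born launch (the counting half of the born SUPPLY law)
# (lane T, crux `TextureLiminfV5`, stmt-Ventures-23912, registered stub `stub_terraceCensus`; (β) assembly RESUME (d′) «born supply», PRESENTABLE-SUPPLY-g24 §3(b))

HONEST FRAMING. Venture `Summits/Ventures/Crystal3D` (cell `crystal3d-full`), route `route-Ventures-StickyWulffConstant`, helper `--supports` the law-v5
crux `TextureLiminfV5` (stmt-Ventures-23912), lane T, mechanism (β).  Pure finite combinatorics (no lattice facts, no census, no certificate); F-C1 not moved.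

THE POINT.  In the born censuses (`born_barlow_endPairs` p751718, `bornMoving_barlow_endPairs`) the launch set is «TRACKABLE ball (`Tr p`: in `X`, straight-moving
in the lamella frame along `c`, predecessor `p − c ∈ X`) whose predecessor is NOT trackable» — abstractly, for ANY predicate `Tr` supported on the finite `X`
and any direction `c` with `c₂ > 0`:
* **`exists_chain_bottom`** — below every trackable ball `p` there is a chain bottom: some `k : ℕ` with `p − j•c` trackable for all `j ≤ k` and `p − (k+1)•c`
  not (the backward chain cannot be infinite inside a finite `X`);
* **`card_trackable_le_mul_card_bottoms`** — if every ball of `X` has height in `[lo, hi]` and `hi − lo < K·c₂`, then for every finite set `R` of trackable balls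
  `#R ≤ K · #{b ∈ X : Tr b ∧ ¬ Tr (b − c)}`: each trackable ball sits on the forward ray of its chain bottom at a step count `< K`.
READING (the born SUPPLY law, counting half): #born launches ≥ (#trackable balls of the lamella)/K with `K ≈ (cell height)/c₂` — for a lamella carrying straight
material through the whole height this is `√2·c₂` launches per unit footprint, the envelope weight of PRESENTABLE-SUPPLY-g24; thinner lamellae scale down linearly
(«ZERO for a lamella with no straight-moving ball», BETA-CUT §4(c)).  The geometric half (how many trackable balls a lamella has; which bottoms step into the census
window) is the assembly's.
WHAT THIS IS NOT: the geometric half of the supply law, any census, any certificate; F-C1 not moved.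
-/

noncomputable section

namespace Summit.Ventures.Crystal3D.Theorems

open Summit.Ventures.Crystal3D Finset
open Summit.Ventures.Crystal3D.Cruxes.TextureLiminf.TexShadow (E3)
open scoped InnerProductSpace

section Chains

variable {X : Finset E3} (Tr : E3 → Prop) (c : E3)

/-- Points of a forward ray with positive climb are distinct: `k ↦ p − k•c` is injective when `c₂ > 0`. -/
theorem sub_natSmul_injective (hc : 0 < c 2) (p : E3) : Function.Injective fun k : ℕ => p - (k : ℝ) • c := by
  intro k k' h
  have h2 := congrArg (fun v : E3 => v 2) h
  simp only [PiLp.sub_apply, PiLp.smul_apply, smul_eq_mul] at h2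
  have : (k : ℝ) = (k' : ℝ) := by
    have := mul_right_cancel₀ hc.ne' (by linarith : (k : ℝ) * c 2 = (k' : ℝ) * c 2)
    exact this
  exact_mod_cast this

/-- **Chain bottoms exist.**  If `Tr` is supported on the finite set `X` and `c₂ > 0`, then below every `Tr`-ball `p` the backward chain `p, p − c, p − 2c, …`
of `Tr`-balls terminates: some `k` with `Tr (p − j•c)` for all `j ≤ k` and `¬ Tr (p − (k+1)•c)`. -/
theorem exists_chain_bottom (hTrX : ∀ q, Tr q → q ∈ X) (hc : 0 < c 2) {p : E3} (hp : Tr p) :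
    ∃ k : ℕ, (∀ j : ℕ, j ≤ k → Tr (p - (j : ℝ) • c)) ∧ ¬ Tr (p - ((k : ℝ) + 1) • c) := by
  classical
  -- some backward step leaves `X`, hence `Tr`
  have hex : ∃ k : ℕ, ¬ Tr (p - (k : ℝ) • c) := by
    by_contra hall
    push Not at hall
    have hsub : (Finset.range (X.card + 1)).image (fun k : ℕ => p - (k : ℝ) • c) ⊆ X := by
      intro q hq
      obtain ⟨k, -, rfl⟩ := mem_image.1 hq
      exact hTrX _ (hall k)
    have hcard := card_le_card hsub
    rw [card_image_of_injective _ (sub_natSmul_injective c hc p), card_range] at hcard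
    omega
  set k₀ := Nat.find hex with hk₀
  have hk₀spec : ¬ Tr (p - (k₀ : ℝ) • c) := Nat.find_spec hex
  have hk₀pos : k₀ ≠ 0 := by
    intro h0
    rw [h0, Nat.cast_zero, zero_smul, sub_zero] at hk₀spec
    exact hk₀spec hp
  obtain ⟨k, hk⟩ := Nat.exists_eq_succ_of_ne_zero hk₀pos
  refine ⟨k, fun j hj => ?_, ?_⟩
  · have hlt : j < k₀ := by rw [hk]; omega
    have := Nat.find_min hex hlt
    simpa using this
  · have e : ((k : ℝ) + 1) = ((k₀ : ℕ) : ℝ) := by rw [hk]; push_cast; ring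
    rw [e]; exact hk₀spec

/-- **The counting half of the born supply law.**  Heights of `X` in `[lo, hi]`, `hi − lo < K·c₂`: every finite set `R` of `Tr`-balls satisfies
`#R ≤ K · #{b ∈ X : Tr b ∧ ¬ Tr (b − c)}` — the chain bottoms are the born launches, each carrying at most `K` trackable balls on its forward ray. -/
theorem card_trackable_le_mul_card_bottoms [DecidablePred Tr] (hTrX : ∀ q, Tr q → q ∈ X) (hc : 0 < c 2)
    {lo hi : ℝ} (hXwin : ∀ q ∈ X, lo ≤ q 2 ∧ q 2 ≤ hi) (K : ℕ) (hK : hi - lo < K * c 2)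
    (R : Finset E3) (hR : ∀ p ∈ R, Tr p) :
    R.card ≤ K * (X.filter fun b => Tr b ∧ ¬ Tr (b - c)).card := by
  classical
  set Bot := X.filter (fun b => Tr b ∧ ¬ Tr (b - c)) with hBot
  -- every trackable ball is `b + k•c` for a bottom `b` and a step count `k < K`
  have hcover : R ⊆ Bot.biUnion fun b => (Finset.range K).image fun k : ℕ => b + (k : ℝ) • c := by
    intro p hp
    obtain ⟨k, hchain, hstop⟩ := exists_chain_bottom Tr c hTrX hc (hR p hp)
    set b : E3 := p - (k : ℝ) • c with hb
    have hTb : Tr b := hchain k le_rfl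
    have hbc : b - c = p - ((k : ℝ) + 1) • c := by rw [hb, add_smul, one_smul, sub_sub]
    have hnot : ¬ Tr (b - c) := by rw [hbc]; exact hstop
    have hbX : b ∈ X := hTrX b hTb
    have hpX : p ∈ X := hTrX p (hR p hp)
    -- the step count is below `K` by the heights
    have hk2 : p 2 - b 2 = (k : ℝ) * c 2 := by
      rw [hb, PiLp.sub_apply, PiLp.smul_apply, smul_eq_mul]; ring
    have hkK : k < K := by
      have h1 := (hXwin p hpX).2
      have h2 := (hXwin b hbX).1
      have h3 : (k : ℝ) * c 2 < (K : ℝ) * c 2 := by linarith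
      exact_mod_cast lt_of_mul_lt_mul_right h3 hc.le
    refine mem_biUnion.2 ⟨b, mem_filter.2 ⟨hbX, hTb, hnot⟩, mem_image.2 ⟨k, mem_range.2 hkK, ?_⟩⟩
    show b + (k : ℝ) • c = p
    rw [hb, sub_add_cancel]
  calc R.card ≤ (Bot.biUnion fun b => (Finset.range K).image fun k : ℕ => b + (k : ℝ) • c).card := card_le_card hcover
    _ ≤ ∑ b ∈ Bot, ((Finset.range K).image fun k : ℕ => b + (k : ℝ) • c).card := card_biUnion_le
    _ ≤ ∑ _b ∈ Bot, K := sum_le_sum fun b _ => card_image_le.trans (card_range K).le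
    _ = K * Bot.card := by rw [sum_const, smul_eq_mul, mul_comm]

/-- **Window form.**  The same with the bottoms split by whether the FIRST STEP `b + c` lands in a height window `(a, a')` (the launches the born census counts)
or not (boundary bottoms, paid by the cell's seals / rims in the assembly):
`#R ≤ K · (#{b : Tr b ∧ ¬Tr (b − c) ∧ a < (b + c)₂ < a'} + #{b : Tr b ∧ ¬Tr (b − c) ∧ ¬(a < (b + c)₂ < a')})`. -/
theorem card_trackable_le_mul_card_bottoms_window [DecidablePred Tr] (hTrX : ∀ q, Tr q → q ∈ X) (hc : 0 < c 2)
    {lo hi : ℝ} (hXwin : ∀ q ∈ X, lo ≤ q 2 ∧ q 2 ≤ hi) (K : ℕ) (hK : hi - lo < K * c 2)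
    (R : Finset E3) (hR : ∀ p ∈ R, Tr p) (a a' : ℝ) :
    R.card ≤ K * (((X.filter fun b => Tr b ∧ ¬ Tr (b - c)).filter fun b => a < (b + c) 2 ∧ (b + c) 2 < a').card +
      ((X.filter fun b => Tr b ∧ ¬ Tr (b - c)).filter fun b => ¬ (a < (b + c) 2 ∧ (b + c) 2 < a')).card) := by
  classical
  rw [card_filter_add_card_filter_not]
  exact card_trackable_le_mul_card_bottoms Tr c hTrX hc hXwin K hK R hR

end Chains

end Summit.Ventures.Crystal3D.Theorems

end
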